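import Std.Data.HashMap
import Mathlib.Data.List.Basic
import Mathlib.Data.List.InsertIdx
import Mathlib.Tactic
import HarnessLib

/-!
# `Lines/toric_sgame.lean` — kernel companion of the (T″) sheet for the double-cubic class (res-B-lens-2 g8, G9/G10; rev 10: model, census
machinery and box certificates — the all-chains theorems are in `Lines/toric_sgame_allchains.lean`)

Crux `stmt-ResolutionOfSingularities-0549` (`Theses.Descent.DescentPerfectToAll`), sub-line `giraud-weak-normal-form`.
LABELS: bears_on LADDER-RESOLUTION:B · [OURS · CANDIDATE] counted 0 · de-risking scaffolding for the Giraud-normal-form sub-line,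
NOT rung-B progress · nothing here proves resolution in char p · resolution in char p NOT proved · AI-written, weaker than expert
review · PURE COMBINATORICS: this file formalises the b-graded toric S-GAME of loop note `giraud-weak-normal-form-RFINE-loop.md` §9 /
sheet `giraud-double-cubic-Tpp-sheet.md` §2 (a MODEL of the S-visible part of a resolution engine on ONE local normal form,
`f = z³/3 + y³/3 + y²g₂ + yg₁ + g₀` near a smooth surface `S` with snc boundary), NOT any statement about schemes. It is a crux
WORKFILE, not a skeleton: it has no `sorry`, registers no stub, and must never be `ledger skeleton check`ed against 0549/0550.

## Contents
* §A `MoveSystem.strong_convergence` — the abstract abelian-game lemma behind sheet S2/S4 («persistence + local commutation ⇒ all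
  complete plays have the same length and end; one complete play bounds every play»; Björner–Lovász–Shor / Eriksson type), fully proved.
* §B the game as a computable model (= `cas/toric_game3.py` rev 3: modes `uv`/`u`, strict legality, variants `topj = 0` (loop-note
  rev 2), `1`, `2 = G_mult`), with the cubic weight `w₃` carried along; ALL-ORDERS exploration (`explore` for the kernel, `exploreM`
  memoised), the (OFF-S) EVENT CENSUS of sheet S6 over every reachable (state, move) of an exponent box, the S3 closed form from
  Hironaka's polygon with the creation criterion (★), persistence/commutation of legal move pairs (S2), and the digest used to
  cross-validate against the Python reference (`cas/ref_stats.py`: identical digests on boxes 2, 3, modes uv/u, topj 0/1/2).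
* §B′–§B⁶ (revs 4–9) MOVED at rev 10 to `Lines/toric_sgame_allchains.lean` (200 000-byte cap per workfile): the KERNEL THEOREMS FOR ALL
  CHAINS AND ALL LEGAL PLAYS over a verbatim copy of the model core of §B — (F2) of loop note §9.15; LEMMA (3) and «cubic-weighted ⇒ w₀ = 0»
  (invariant `Inv3`); THEOREM (4): monic centres, monic neighbours at D/A accepts and at Sing₂ points of AL accepts (`Inv4`), the shape
  of the residual configuration (`Inv6`, `residual_shape_*`), no cubic weight at top points; PROPOSITION (5): the birth-record extension
  (`GCurve`, `proj_gApplyMoves`), the far-side lemma (`I5`, `farside_*`) and the genesis bookkeeping (`G1/G0/B2/I8/NB`, `prop5_*`);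
  HEADLINE `monic_neighbours_all_gmult|uv`: from every cubic-free initial chain of length ≤ 2 (all box seeds, all weights), along every
  legal play, at every accept `D/A/AL` both branches at every point of the centre have `w₃ = 0` — §9.15 (3)–(5) are kernel theorems.
  This file keeps the model, the all-orders / census machinery and the box certificates (the computational cross-check of the same facts).
* §C certificates: kernel `decide` on seeds (the T-chain witness of E-S6(iv); the loose-legality infinite play; the box-5 seed
  killing the naive invariant) and `native_decide` box theorems (boxes ≤ 4; they depend on the axiom `Lean.ofReduceBool`, i.e. on the
  compiler — census-level evidence, exactly like the Python runs they replace, but with the statement pinned in Lean).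

## What the box theorems say (sheet dictionary) — `boxCensus topj modeUV maxw fuel = (#states, [#events, b1,b2,b3, a1,…,a6, #Bennett])`
`b1` α=3 blow-ups whose centre carries cubic weight (`o₃ ≥ 1`); `b2` … with moreover `o₂ ≥ 2` (LEMMA 9.12: never); `b3` (Q₂)-lines born
(α=2, `o₃ ≥ 1`: multiplicity 2, ν_J = 2); `a1/a2/a3` deep / borderline / light accepts whose centre has `w₃ ≥ 1`; `a4` accepts with a
NEIGHBOUR of cubic weight `w₃′ ≥ 1` (the neighbours' lemma §9.14 (5)); `a5` α=2 accepts THROUGH A TOP POINT (not Hironaka-permissible);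
`a6` accepts creating a MULTIPLICITY-3 POINT OFF S at a distinguished point over an end node (`mult3AtEnd`, exact for all unit values
at those points; E-S6(iv)); `#Bennett` states with a point of multiplicity ≥ 4.  RESULTS (all legal orders, every Sing₂-origin seed):
mode `uv` (rev 2 = G_mult) boxes 3 | 4: `(13681,[24477,0,0,32,0,0,0,0,0,0,0])` | `(105565,[330748,0,0,150,0,0,0,0,0,0,0])`;
mode `u`, `G_mult`: `(10552,[18168,0,0,16,0,…,0])` | `(87571,[263014,0,0,75,0,…,0])` — the cubic is MONIC at every centre and at every
neighbour of every accepted centre, no accept passes a top point, no multiplicity-3 point is created off S at the distinguished points,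
Bennett holds; mode `u`, rev 2 (WITHDRAWN rule set): `(10011,[16643,18,0,16,0,0,4,0,622,4,0])` | `(81762,[239129,70,0,81,0,0,67,3,4631,52,0])`
— T-chains: 70 cubic-weighted α=3 centres, 67 light accepts with `w₃ ≥ 1`, 52 multiplicity-3 points off S, and 3 accepts next to a
cubic-weighted neighbour (`rev2_u4_neighbour_events`: an ERRATUM to the census sentence of §9.14 (5), whose harvests did not contain the
seeds `c = (4,1,1)`, `w(V(s)) ∈ {(2,4,0),(3,3,0),(3,4,0)}`; all three sit inside T-chains, i.e. inside the withdrawn rev-2 behaviour).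
The by-hand proof that `b1 = a1 = a2 = a3 = a4 = 0` in EVERY legal play (mode `uv` and `G_mult`, all weights) is loop note §9.15
(rev 1.12, this generation); these theorems are its cross-check on the boxes, not its proof; `f2_*` certify its load-bearing fact (F2)
(accepts only at w₀ = 2 through points with partner order 0) on box 4 and show the withdrawn rev-2 rules violating it 1 164 + 4 543 times;
since rev 4 (F2), since revs 5–8 LEMMA (3) / THEOREM (4) up to the dry-point case, and since rev 9 PROPOSITION (5) and THEOREM (4) in full (every
seed of length ≤ 2) are KERNEL THEOREMS for all chains and plays — now in `Lines/toric_sgame_allchains.lean` (census counters b1, b2, a1–a4 of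
§9.15 (1) become corollaries on every seed; the `f2_*` / `census_*` box theorems of §C remain as the cross-check and the rev-2 contrast).
MEASURED ON BOX 5, NOT SHIPPED (`#eval` through `lean check` on the farm, rc 0, 381–511 s each; fuel 160): `boxCensus 0 true 5 160 =
(722949,[3449855,0,0,502,0,0,0,0,0,0,0])`, `boxCensus 2 false 5 160 = (615933,[2815125,0,0,251,0,0,0,0,0,0,0])`, `boxF2 0 true 5 160 = [0,0,0]`,
`boxF2 2 false 5 160 = [0,0,0]`, `boxAllOrdersOK 0 true 5 160 = true`, `boxAllOrdersOK 2 false 5 160 = true`, `boxInv 0 true 5 160 =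
(722949,[190,0,0,0,0])`, `boxInv 2 false 5 160 = (615933,[81,0,0,0,0])` (the naive pattern `s1` occurs, `s2`–`s5` do not) — i.e. on box 5 too,
mode `uv` and `G_mult`: all orders agree, `b1 = b2 = a1 = … = a6 = 0`, (F2) holds.
GEOMETRIC CROSS-CHECK OUTSIDE LEAN (loop note §9.15 (7); HOME `g8/cas/atlas/`): the log-Jacobian engine of g6 with a multiplicity trigger
(`coupled_sim3g.py`, TOPJ = 2) reproduces the `G_mult` plays of this model move-type for move-type on 1 482 initial states of the boxes ≤ 4
(boxes ≤ 2 exhaustively) and its blow-up atlas finds no multiplicity-3 point off S in any of them, while the rev-2 engine leaves one on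
the T-chain witness and on each E-9.14(5) seed.
-/

set_option linter.dupNamespace false
set_option linter.style.longLine false
set_option autoImplicit false

namespace Summit.ResolutionOfSingularities.ResolutionOfSingularities.Cruxes.DescentPerfectToAll.GiraudWeakNormalForm.ToricSGame

/-! ## §A. Strong convergence of abelian move systems (Björner–Lovász–Shor type lemma), sorry-free. -/

/-- An abstract move system: states `S`, move labels `M`, a legality predicate and a transition map. -/
structure MoveSystem (S M : Type*) where
  legal : S → M → Prop
  apply : S → M → S

namespace MoveSystem

variable {S M : Type*}

/-- `G.IsPlay s l`: the moves of `l` are legal one after the other starting from `s`. -/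
def IsPlay (G : MoveSystem S M) : S → List M → Prop
  | _, [] => True
  | s, m :: l => G.legal s m ∧ IsPlay G (G.apply s m) l

variable (G : MoveSystem S M)

/-- The state reached from `s` after playing `l`. -/
def run (s : S) (l : List M) : S := l.foldl G.apply s

/-- A state with no legal move. -/
def Terminal (s : S) : Prop := ∀ m, ¬ G.legal s m

/-- PERSISTENCE: a legal move stays legal when a different legal move is played. -/
def Persistent : Prop := ∀ s m m', G.legal s m → G.legal s m' → m ≠ m' → G.legal (G.apply s m') m

/-- LOCAL COMMUTATION: two legal moves commute. -/
def Commutes : Prop := ∀ s m m', G.legal s m → G.legal s m' → G.apply (G.apply s m) m' = G.apply (G.apply s m') m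

@[simp] theorem isPlay_nil (s : S) : G.IsPlay s [] := trivial
@[simp] theorem isPlay_cons (s : S) (m : M) (l : List M) :
    G.IsPlay s (m :: l) ↔ G.legal s m ∧ G.IsPlay (G.apply s m) l := Iff.rfl
@[simp] theorem run_nil (s : S) : G.run s [] = s := rfl
@[simp] theorem run_cons (s : S) (m : M) (l : List M) : G.run s (m :: l) = G.run (G.apply s m) l := rfl

theorem isPlay_append (s : S) (l₁ l₂ : List M) :
    G.IsPlay s (l₁ ++ l₂) ↔ G.IsPlay s l₁ ∧ G.IsPlay (G.run s l₁) l₂ := by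
  induction l₁ generalizing s with
  | nil => simp
  | cons m l ih => simp [ih, and_assoc]

theorem run_append (s : S) (l₁ l₂ : List M) : G.run s (l₁ ++ l₂) = G.run (G.run s l₁) l₂ := by
  simp [run, List.foldl_append]

variable {G}

/-- Exchange lemma: in a persistent commuting system, a move `q` legal at `s` can be moved to the FRONT of any
complete play `P` from `s`: the rest is a complete play from `G.apply s q`, one move shorter, with the same end state. -/
theorem exists_front (hP : G.Persistent) (hC : G.Commutes) :
    ∀ (P : List M) (s : S) (q : M), G.IsPlay s P → G.Terminal (G.run s P) → G.legal s q →
      ∃ P' : List M, G.IsPlay (G.apply s q) P' ∧ P'.length + 1 = P.length ∧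
        G.run (G.apply s q) P' = G.run s P
  | [], s, q, _, hT, hq => (hT q (by simpa using hq)).elim
  | m :: P₁, s, q, hplay, hT, hq => by
      rcases hplay with ⟨hm, hP₁⟩
      by_cases hmq : m = q
      · subst hmq
        exact ⟨P₁, hP₁, by simp, rfl⟩
      · have hq' : G.legal (G.apply s m) q := hP s q m hq hm (Ne.symm hmq)
        obtain ⟨P₁', hplay', hlen, hrun⟩ :=
          exists_front hP hC P₁ (G.apply s m) q hP₁ (by simpa using hT) hq'
        have hcomm : G.apply (G.apply s m) q = G.apply (G.apply s q) m := hC s m q hm hq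
        refine ⟨m :: P₁', ⟨hP s m q hm hq hmq, hcomm ▸ hplay'⟩, by simp [hlen], ?_⟩
        rw [run_cons, ← hcomm, hrun, run_cons]

/-- STRONG CONVERGENCE. If some complete (= terminal-ending) play `P` from `s` exists, then every play `Q` from `s` has
`Q.length ≤ P.length`, and every complete play from `s` has the same length and the same end state as `P`. -/
theorem strong_convergence (hP : G.Persistent) (hC : G.Commutes) :
    ∀ (Q : List M) (s : S) (P : List M), G.IsPlay s P → G.Terminal (G.run s P) → G.IsPlay s Q →
      Q.length ≤ P.length ∧ (G.Terminal (G.run s Q) → Q.length = P.length ∧ G.run s Q = G.run s P)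
  | [], s, P, hPp, _, _ => by
      refine ⟨by simp, fun hTQ => ?_⟩
      cases P with
      | nil => simp
      | cons m P₁ => exact (hTQ m (by simpa using hPp.1)).elim
  | q :: Q₁, s, P, hPp, hT, hQ => by
      rcases hQ with ⟨hq, hQ₁⟩
      obtain ⟨P', hP'play, hlen, hrun⟩ := exists_front hP hC P s q hPp hT hq
      have hT' : G.Terminal (G.run (G.apply s q) P') := by rw [hrun]; exact hT
      obtain ⟨hle, hterm⟩ := strong_convergence hP hC Q₁ (G.apply s q) P' hP'play hT' hQ₁
      refine ⟨by simp; omega, fun hTQ => ?_⟩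
      obtain ⟨h1, h2⟩ := hterm (by simpa using hTQ)
      exact ⟨by simp; omega, by rw [run_cons, h2, hrun]⟩

/-- Corollary (ABELIAN PROPERTY): two complete plays from the same state have equal length and equal end state. -/
theorem complete_unique (hP : G.Persistent) (hC : G.Commutes) {s : S} {P Q : List M}
    (hPp : G.IsPlay s P) (hPT : G.Terminal (G.run s P)) (hQp : G.IsPlay s Q) (hQT : G.Terminal (G.run s Q)) :
    Q.length = P.length ∧ G.run s Q = G.run s P :=
  ((strong_convergence hP hC Q s P hPp hPT hQp).2 hQT)

/-- Corollary (TERMINATION UNDER EVERY ORDER from termination under ONE order): if a complete play of length `n`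
exists from `s`, no play from `s` is longer than `n`; in particular there is no infinite play. -/
theorem length_le_of_complete (hP : G.Persistent) (hC : G.Commutes) {s : S} {P Q : List M}
    (hPp : G.IsPlay s P) (hPT : G.Terminal (G.run s P)) (hQp : G.IsPlay s Q) : Q.length ≤ P.length :=
  (strong_convergence hP hC Q s P hPp hPT hQp).1

/-- No infinite play: an `ℕ`-indexed sequence of moves all of whose finite prefixes are plays cannot exist once one
complete play exists. -/
theorem no_infinite_play (hP : G.Persistent) (hC : G.Commutes) {s : S} {P : List M}
    (hPp : G.IsPlay s P) (hPT : G.Terminal (G.run s P)) (f : ℕ → M)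
    (hf : ∀ n, G.IsPlay s ((List.range n).map f)) : False := by
  have h := length_le_of_complete hP hC hPp hPT (hf (P.length + 1))
  simp at h

end MoveSystem

/-! ## §B. The b-graded toric S-game (computable model of `toric_game3.py`). -/

/-- One grade weight `w_b = ord_C(g_b)`; `none` = ∞ (the class part `g_b` is identically zero). -/
abbrev Wt := Option ℕ

/-- `w ≥ t` for a grade weight (`∞ ≥ t` always). -/
def wge (w : Wt) (t : ℕ) : Bool := match w with | none => true | some n => Nat.ble t n

/-- `1 ≤ c < ∞`. -/
def finPos (c : Wt) : Bool := match c with | none => false | some n => Nat.ble 1 n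

/-- Sum of grade weights (∞ absorbing). -/
def wadd : Wt → Wt → Wt
  | some x, some y => some (x + y)
  | _, _ => none

/-- The weight vector `(w₀, w₁, w₂)` of a curve (orders of the three class parts `g₀, g₁, g₂`). -/
structure W3 where
  w0 : Wt
  w1 : Wt
  w2 : Wt
deriving DecidableEq, Repr, Inhabited, Hashable

namespace W3
/-- componentwise `w ≥ (t₀,t₁,t₂)` -/
def ge (w : W3) (t0 t1 t2 : ℕ) : Bool := wge w.w0 t0 && wge w.w1 t1 && wge w.w2 t2
/-- node order `o = w' + w''` -/
def add (a b : W3) : W3 := ⟨wadd a.w0 b.w0, wadd a.w1 b.w1, wadd a.w2 b.w2⟩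
/-- accept: `w ↦ w − (d₀,d₁,d₂)` -/
def sub (w : W3) (d0 d1 d2 : ℕ) : W3 := ⟨w.w0.map (· - d0), w.w1.map (· - d1), w.w2.map (· - d2)⟩
end W3

/-- thresholds: `θ = (3,2,1)` (TOP / DEEP), `(2,2,1)` (Sing₂), `(2,1,0)` (class 𝒞). -/
def isDeepW (w : W3) : Bool := w.ge 3 2 1
def isSingW (w : W3) : Bool := w.ge 2 2 1
def isCW (w : W3) : Bool := w.ge 2 1 0

/-- A curve of the chain: class weights `w`, the CUBIC weight `w3 = ord_C` of the class-3 part `(z³+y³)/3` (θ₃ = 3; it never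
influences legality — bookkeeping for the (OFF-S) census of §9.12/9.14), and the flag `bd` (`true` = boundary/exceptional curve, a legal
centre; `false` = the residual transversal branch `R` of mode `u`, never a centre; its weights are the residual exponents `c`). -/
structure Curve where
  w : W3
  w3 : ℕ
  bd : Bool
deriving DecidableEq, Repr, Inhabited, Hashable

/-- The state: the chain of curves `K₀ — K₁ — ⋯ — K_n`; point `i` is the node between `K_i` and `K_{i+1}`. -/
abbrev Chain := List Curve

/-- Moves: `D k` accept the deep curve `k` (α = 3); `A k` / `AL k` accept the borderline / relevant light curve `k` (α = 2);
`I i` blow up the jump (or, under `G_mult`, top) point `i` of a handled curve (α = 3); `P i` blow up the isolated Sing₂ point `i`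
(α = 3 if top, else 2). -/
inductive Move
  | D (k : ℕ) | A (k : ℕ) | AL (k : ℕ) | I (i : ℕ) | P (i : ℕ)
deriving DecidableEq, Repr

inductive Kind | resid | deep | borderline | light | none
deriving DecidableEq, Repr

def kindOf (c : Curve) : Kind :=
  if !c.bd then .resid else if isDeepW c.w then .deep else if isSingW c.w then .borderline
  else if isCW c.w then .light else .none

/-- the two branches at point `i` -/
def nodeAt (ch : Chain) (i : ℕ) : Option (Curve × Curve) :=
  match ch[i]?, ch[i+1]? with
  | some a, some b => some (a, b)
  | _, _ => none

/-- residual exponents at a T-point (`none` at a 𝒟-node) -/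
def resid (a b : Curve) : Option W3 := if !a.bd then some a.w else if !b.bd then some b.w else none

/-- `x ∈ Sing₂` (multiplicity / ν dictionary 9.3′, T-point rule rev 2: `c₀ ≥ 1 ⇒ o₀ ≥ 3`, `c₁ ≥ 1 ⇒ o₁ ≥ 2`, `c₂ ≥ 1 ⇒ o₂ ≥ 1`). -/
def sing2N (a b : Curve) : Bool :=
  let o := a.w.add b.w
  isSingW o &&
  (match resid a b with
   | none => true
   | some c => (!finPos c.w0 || wge o.w0 3) && (!finPos c.w1 || wge o.w1 2) && (!finPos c.w2 || wge o.w2 1))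

/-- `x` TOP (multiplicity 3): Sing₂ and `o ≥ θ`. -/
def topN (a b : Curve) : Bool := sing2N a b && isDeepW (a.w.add b.w)

/-- `x` a JUMP point of a (non-deep, class-𝒞) curve through it: top, and at a T-point `c_b ≥ 1 ⇒ o_b ≥ 4 − b`. -/
def jumpN (a b : Curve) : Bool :=
  let o := a.w.add b.w
  topN a b &&
  (match resid a b with
   | none => true
   | some c => (!finPos c.w0 || wge o.w0 4) && (!finPos c.w1 || wge o.w1 3) && (!finPos c.w2 || wge o.w2 2))

def sing2At (ch : Chain) (i : ℕ) : Bool := match nodeAt ch i with | some (a, b) => sing2N a b | none => false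
def topAt (ch : Chain) (i : ℕ) : Bool := match nodeAt ch i with | some (a, b) => topN a b | none => false
def jumpAt (ch : Chain) (i : ℕ) : Bool := match nodeAt ch i with | some (a, b) => jumpN a b | none => false
def kindAt (ch : Chain) (k : ℕ) : Kind := match ch[k]? with | some c => kindOf c | none => .none

/-- the points (node indices) of curve `k` in a chain of length `n` -/
def ptsOf (n k : ℕ) : List ℕ := (if 1 ≤ k then [k - 1] else []) ++ (if k + 1 < n then [k] else [])

/-- a light curve is RELEVANT iff one of its points is in Sing₂ -/
def relevantLight (ch : Chain) (k : ℕ) : Bool := kindAt ch k == .light && (ptsOf ch.length k).any (sing2At ch)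

/-- curves that HANDLE their points (curves first at points): deep, borderline, relevant light -/
def handled (ch : Chain) (k : ℕ) : Bool :=
  kindAt ch k == .deep || kindAt ch k == .borderline || relevantLight ch k

/-- The LEGAL MOVES under STRICT legality (deep-first; curves first at points), variant `topj`:
`topj = 0` = loop-note rev 2; `topj = 1` = rev 3 (top points on relevant light curves are blown up first);
`topj = 2` = `G_mult` (top points on borderline curves too). The list is the SET of legal moves (any order = rule `free`). -/
def legalMoves (topj : ℕ) (ch : Chain) : List Move :=
  let n := ch.length
  let idx := List.range n
  match idx.filter (fun k => kindAt ch k == .deep) with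
  | k :: _ => [Move.D k]
  | [] =>
    let curveMoves := idx.flatMap (fun k =>
      match kindAt ch k with
      | .borderline =>
          let js := (ptsOf n k).filter (fun i => jumpAt ch i || (Nat.ble 2 topj && topAt ch i))
          if js.isEmpty then [Move.A k] else js.map Move.I
      | .light =>
          if (ptsOf n k).any (sing2At ch) then
            let js := (ptsOf n k).filter (fun i => jumpAt ch i || (Nat.ble 1 topj && topAt ch i))
            if js.isEmpty then [Move.AL k] else js.map Move.I
          else []
      | _ => [])
    let pMoves := ((List.range (n - 1)).filter
      (fun i => sing2At ch i && !handled ch i && !handled ch (i + 1))).map Move.P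
    curveMoves ++ pMoves

/-- LOOSE legality (for contrast only; = `coupled_sim3`'s `free2`): isolated point blow-ups are also allowed at points of
relevant light curves. It admits an infinite legal play (§C). -/
def looseMoves (topj : ℕ) (ch : Chain) : List Move :=
  let n := ch.length
  legalMoves topj ch ++ ((List.range (n - 1)).filter
      (fun i => sing2At ch i && relevantLight ch i || sing2At ch i && relevantLight ch (i + 1))).map Move.P

/-- TERMINAL: no deep/borderline curve and no Sing₂ point. -/
def terminalB (ch : Chain) : Bool :=
  (List.range ch.length).all (fun k => kindAt ch k != .deep && kindAt ch k != .borderline) &&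
  (List.range (ch.length - 1)).all (fun i => !sing2At ch i)

/-- blow up point `i` with exponent `α`: newborn curve with `w_b = o_b + b − α`, inserted between the two branches. -/
def blowup (ch : Chain) (i α : ℕ) : Chain :=
  match nodeAt ch i with
  | none => ch
  | some (a, b) =>
    let o := a.w.add b.w
    ch.insertIdx (i + 1) ⟨⟨o.w0.map (· - α), o.w1.map (· + 1 - α), o.w2.map (· + 2 - α)⟩, a.w3 + b.w3 + 3 - α, true⟩

/-- play one move -/
def applyMove (ch : Chain) : Move → Chain
  | .D k => ch.modify k (fun c => { c with w := c.w.sub 3 2 1 })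
  | .A k => ch.modify k (fun c => { c with w := c.w.sub 2 1 0, w3 := c.w3 + 1 })
  | .AL k => ch.modify k (fun c => { c with w := c.w.sub 2 1 0, w3 := c.w3 + 1 })
  | .I i => blowup ch i 3
  | .P i => blowup ch i (if topAt ch i then 3 else 2)

/-- play a list of moves -/
def applyMoves (ch : Chain) (l : List Move) : Chain := l.foldl applyMove ch

/-- is `l` a legal play from `ch` (every move legal when played)? -/
def isLegalPlay (topj : ℕ) : Chain → List Move → Bool
  | _, [] => true
  | ch, m :: l => (legalMoves topj ch).contains m && isLegalPlay topj (applyMove ch m) l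

/-- ALL ORDERS, memo-free (kernel `decide` on small seeds): `some (n, end)` iff EVERY maximal strictly-legal play from `ch`
terminates within `fuel` moves, all with the same length `n` and the same end chain; `none` otherwise. -/
def explore (topj : ℕ) : ℕ → Chain → Option (ℕ × Chain)
  | 0, _ => none
  | fuel + 1, ch =>
    if terminalB ch then some (0, ch) else
    match legalMoves topj ch with
    | [] => none
    | m :: ms =>
      let r := explore topj fuel (applyMove ch m)
      if ms.all (fun m' => explore topj fuel (applyMove ch m') == r) then r.map (fun p => (p.1 + 1, p.2)) else none

/-- memo table for `exploreM` -/
abbrev Memo := Std.HashMap Chain (Option (ℕ × Chain))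

/-- ALL ORDERS with memoisation (for `native_decide` box certificates); same contract as `explore`
(a cached `none` obtained with less fuel only makes the answer more conservative). -/
def exploreM (topj : ℕ) : ℕ → Chain → Memo → Option (ℕ × Chain) × Memo
  | 0, _, memo => (none, memo)
  | fuel + 1, ch, memo =>
    match memo.get? ch with
    | some r => (r, memo)
    | none =>
      let res : Option (ℕ × Chain) × Memo :=
        if terminalB ch then (some (0, ch), memo) else
        match legalMoves topj ch with
        | [] => (none, memo)
        | m :: ms =>
          let p0 := exploreM topj fuel (applyMove ch m) memo
          let r0 := p0.1
          let acc := ms.foldl (fun (acc : Bool × Memo) m' =>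
              let p := exploreM topj fuel (applyMove ch m') acc.2
              (acc.1 && (p.1 == r0), p.2)) (true, p0.2)
          (if acc.1 then r0.map (fun p => (p.1 + 1, p.2)) else none, acc.2)
      (res.1, res.2.insert ch res.1)

/-- one deterministic strict order (chain order; `A < AL < I < P` groups as in `alpha2`): length of the play, or `none` if fuel runs out / stuck -/
def runDet (topj : ℕ) : ℕ → Chain → Option (ℕ × Chain)
  | 0, _ => none
  | fuel + 1, ch =>
    if terminalB ch then some (0, ch) else
    let ms := legalMoves topj ch
    let pick := (ms.find? (fun m => match m with | .D _ => true | _ => false)) <|>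
      (ms.find? (fun m => match m with | .A _ => true | _ => false)) <|>
      (ms.find? (fun m => match m with | .AL _ => true | _ => false)) <|>
      (ms.find? (fun m => match m with | .I _ => true | _ => false)) <|> ms.head?
    match pick with
    | none => none
    | some m => (runDet topj fuel (applyMove ch m)).map (fun p => (p.1 + 1, p.2))

/-! ### Initial states (the exponent boxes of the censuses) -/

def wtVals (maxw : ℕ) : List Wt := (List.range (maxw + 1)).map some ++ [none]

def allW3 (maxw : ℕ) : List W3 :=
  (wtVals maxw).flatMap fun a => (wtVals maxw).flatMap fun b => (wtVals maxw).map fun c => ⟨a, b, c⟩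

/-- initial chain: mode `uv` = `[V(t) (boundary), V(s) (boundary)]`; mode `u` = `[R (residual, exponents c), V(s)]` -/
def initChain (modeUV : Bool) (ws wt : W3) : Chain := [⟨wt, 0, modeUV⟩, ⟨ws, 0, true⟩]

/-- class conditions at the start (toric_game3.py `__main__`): `g_b ≡ 0` consistently on both branches, not all three `≡ 0`,
in mode `u` the residual branch is not of multiplicity `≥ θ` (`Top¹ ⊆ 𝒟`), and the origin lies in Sing₂. -/
def initOK (modeUV : Bool) (ws wt : W3) : Bool :=
  (ws.w0.isNone == wt.w0.isNone) && (ws.w1.isNone == wt.w1.isNone) && (ws.w2.isNone == wt.w2.isNone) &&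
  !(ws.w0.isNone && ws.w1.isNone && ws.w2.isNone) &&
  (modeUV || !isDeepW wt) &&
  sing2At (initChain modeUV ws wt) 0

def initStates (modeUV : Bool) (maxw : ℕ) : List Chain :=
  ((allW3 maxw).flatMap fun ws => (allW3 maxw).map fun wt => (ws, wt)).filterMap
    fun p => if initOK modeUV p.1 p.2 then some (initChain modeUV p.1 p.2) else none

/-- BOX CERTIFICATE (S2 + S4 on a box): every initial state of the box has all its maximal strict plays finite (≤ fuel),
of equal length and equal end. -/
def boxAllOrdersOK (topj : ℕ) (modeUV : Bool) (maxw fuel : ℕ) : Bool :=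
  ((initStates modeUV maxw).foldl (fun (acc : Bool × Memo) ch =>
      let p := exploreM topj fuel ch acc.2
      (acc.1 && p.1.isSome, p.2)) (true, ({} : Memo))).1

/-- statistics: number of initial states and maximal play length on the box (deterministic order) -/
def boxStats (topj : ℕ) (modeUV : Bool) (maxw fuel : ℕ) : ℕ × Option ℕ :=
  let ss := initStates modeUV maxw
  (ss.length, (ss.map fun ch => (runDet topj fuel ch).map (·.1)).foldl
     (fun acc r => match acc, r with | some a, some b => some (max a b) | _, _ => none) (some 0))

/-! ### (OFF-S) event census over ALL legal plays (sheet S6 / loop note §9.12 LEMMA, §9.14): reachable (state, move) events -/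

/-- `2·w + e` on grade weights (`∞` absorbing). -/
def dbl (w e : Wt) : Wt := wadd (w.map (2 * ·)) e

/-- MULTIPLICITY-3 TEST at the two distinguished points of the free-direction charts over an END NODE of an accept (exceptional
exponent `α`) of the curve `c` against the partner datum `nb` (exponents `e = nb.w`, cubic weight `e₃ = nb.w3`; the residual branch has
`e = c`, `e₃ = 0`). In the `z`-chart (`y = zy′`, `u = zu′`) the class-`b` term has order `2b + 2w_b + e_b − α` at `q_z = (1:0:0)` and the
cubic `z^{3−α+w₃}u′^{w₃}v^{e₃}(1+y′³)/3` has order `3 − α + 2w₃ + e₃`; in the `y`-chart at `q_a = (a:1:0)`, `a³ = −1`, the orders are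
`b + 2w_b + e_b − α` and `4 − α + 2w₃ + e₃` (the cubic factor `z′³ + 1` is a local parameter there). Distinct monomials with unit
coefficients: the multiplicity IS the least order, for all unit values. Returns `mult(q_z) ≥ 3 ∨ mult(q_a) ≥ 3`.
(Check: `α = 2`, `w₃ = e₃ = 0` gives `mult(q_a) = 2 ⟺ (w₁ = 1 ⇒ e₁ ≥ 1) ∧ (w₂ = 0 ⇒ e₂ ≥ 2)` = the node-end double points of S6 (iii),
and `mult(q_z) = 3 ⟺ 2w₁ + c₁ ≥ 3 ∧ 2w₀ + c₀ ≥ 5` when `w₃ ≥ 1`, `w₂ = 0`, `c₂ = 1` = E-S6(iv).) -/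
def mult3AtEnd (α : ℕ) (c nb : Curve) : Bool :=
  let t3 := 2 * c.w3 + nb.w3
  let d0 := dbl c.w.w0 nb.w.w0
  let d1 := dbl c.w.w1 nb.w.w1
  let d2 := dbl c.w.w2 nb.w.w2
  (Nat.ble α t3 && wge d0 (3 + α) && wge d1 (1 + α) && wge d2 (α - 1)) ||
  (Nat.ble α (t3 + 1) && wge d0 (3 + α) && wge d1 (2 + α) && wge d2 (1 + α))

/-- flags of a point blow-up of node `i` with exponent `α`:
`[b1] α = 3 ∧ o₃ ≥ 1` (cubic weight at a multiplicity-3 centre), `[b2] α = 3 ∧ o₃ ≥ 1 ∧ o₂ ≥ 2` (LEMMA: never),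
`[b3] α = 2 ∧ o₃ ≥ 1` (a (Q₂)-line `L_x` is born: multiplicity 2, ν_J = 2 along it). -/
def blowFlags (ch : Chain) (i α : ℕ) : List Bool :=
  match nodeAt ch i with
  | none => [false, false, false]
  | some (a, b) =>
    let o := a.w.add b.w
    let o3p := Nat.ble 1 (a.w3 + b.w3)
    [α == 3 && o3p, α == 3 && o3p && wge o.w2 2, α == 2 && o3p]

/-- flags of an accept of curve `k` (exponent `α`, kind `kd`):
`[a1] deep accept with w₃ ≥ 1` (LEMMA: never), `[a2] borderline accept with w₃ ≥ 1` (LEMMA: never), `[a3] light accept with w₃ ≥ 1`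
(a SECOND accept of a light curve: rev-2 mode-u T-chains only), `[a4]` a neighbour of the centre has cubic weight `w₃′ ≥ 1`
(§9.14 (5), the neighbours' lemma: never), `[a5]` an `α = 2` accept THROUGH A TOP POINT (not Hironaka-permissible; impossible under
`G_mult` and in mode `uv`), `[a6]` a MULTIPLICITY-3 POINT OFF S is created at an end of the accept (`mult3AtEnd`; E-S6(iv)). -/
def accFlags (ch : Chain) (k α : ℕ) (kd : Kind) : List Bool :=
  match ch[k]? with
  | none => [false, false, false, false, false, false]
  | some c =>
    let nbs : List Curve := (if 1 ≤ k then (ch[k-1]?).toList else []) ++ (ch[k+1]?).toList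
    let w3p := Nat.ble 1 c.w3
    [kd == .deep && w3p, kd == .borderline && w3p, kd == .light && w3p,
     nbs.any (fun nb => Nat.ble 1 nb.w3),
     α == 2 && (ptsOf ch.length k).any (topAt ch),
     nbs.any (mult3AtEnd α c)]

/-- the census row of a legal move `m` at `ch`: `[1 (one event)] ++ blowFlags ++ accFlags ++ [0]` (11 entries). -/
def eventFlags (ch : Chain) (m : Move) : List Bool :=
  let z3 := [false, false, false]
  let z6 := [false, false, false, false, false, false]
  [true] ++ (match m with
  | .I i => blowFlags ch i 3 ++ z6
  | .P i => blowFlags ch i (if topAt ch i then 3 else 2) ++ z6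
  | .D k => z3 ++ accFlags ch k 3 .deep
  | .A k => z3 ++ accFlags ch k 2 .borderline
  | .AL k => z3 ++ accFlags ch k 2 .light) ++ [false]

/-- the census row of a STATE: last entry = some node has `o ≥ (4,3,2)` and `o₃ ≥ 1`, i.e. a point of MULTIPLICITY ≥ 4
(Bennett's bound violated) — never. -/
def stateFlags (ch : Chain) : List Bool :=
  let bad := (List.range (ch.length - 1)).any fun i => match nodeAt ch i with
    | some (a, b) => (a.w.add b.w).ge 4 3 2 && Nat.ble 1 (a.w3 + b.w3)
    | none => false
  [false, false, false, false, false, false, false, false, false, false, bad]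

def addCounts (a : List ℕ) (f : List Bool) : List ℕ := (a.zip f).map fun p => p.1 + (if p.2 then 1 else 0)

abbrev Seen := Std.HashMap Chain Unit

/-- visit every state reachable by strictly-legal plays (ALL orders) within `fuel`, adding the state row once and the row of every
legal move at it once -/
def censusM (topj : ℕ) : ℕ → Chain → Seen × List ℕ → Seen × List ℕ
  | 0, _, acc => acc
  | fuel + 1, ch, acc =>
    if acc.1.contains ch then acc else
    let ms := legalMoves topj ch
    let cnt := ms.foldl (fun c m => addCounts c (eventFlags ch m)) (addCounts acc.2 (stateFlags ch))
    ms.foldl (fun (a : Seen × List ℕ) m => censusM topj fuel (applyMove ch m) a) (acc.1.insert ch (), cnt)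

/-- (OFF-S) EVENT CENSUS of a box = (number of reachable states, `[#events, b1, b2, b3, a1, a2, a3, a4, a5, a6, #states violating Bennett]`). -/
def boxCensus (topj : ℕ) (modeUV : Bool) (maxw fuel : ℕ) : ℕ × List ℕ :=
  let r := (initStates modeUV maxw).foldl (fun a ch => censusM topj fuel ch a) (({} : Seen), [0,0,0,0,0,0,0,0,0,0,0])
  (r.1.size, r.2)

/-! ### S3: the closed form from Hironaka's polygon (mode `uv`, monomial data) -/

/-- `⟨v, e_b⟩` for the ray `v = (v_s, v_t)` and the exponent vector `e_b = (ws_b, wt_b)` (`none` if `g_b ≡ 0`) -/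
def pairing (v : ℕ × ℕ) (es et : Wt) : Wt := match es, et with
  | some a, some c => some (v.1 * a + v.2 * c) | _, _ => none

/-- `⌊N(v)⌋ = min_b ⌊⟨v,e_b⟩ / θ_b⌋` over the grades with `g_b ≢ 0` (`θ = (3,2,1)`) -/
def floorN (v : ℕ × ℕ) (ws wt : W3) : ℕ :=
  let c (es et : Wt) (θ : ℕ) : List ℕ := match pairing v es et with | some m => [m / θ] | none => []
  (c ws.w0 wt.w0 3 ++ c ws.w1 wt.w1 2 ++ c ws.w2 wt.w2 1).foldl min 1000000

/-- `N(v) ≥ k` (integer `k`) iff `⟨v,e_b⟩ ≥ k θ_b` for every grade present -/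
def NgeInt (v : ℕ × ℕ) (ws wt : W3) (k : ℕ) : Bool :=
  wge (pairing v ws.w0 wt.w0) (3 * k) && wge (pairing v ws.w1 wt.w1) (2 * k) && wge (pairing v ws.w2 wt.w2) k

/-- the closed form `w_b(E_v) = M_b(v) − θ_b ⌊N(v)⌋` -/
def closedFormHolds (v : ℕ × ℕ) (ws wt : W3) (c : Curve) : Bool :=
  let f := floorN v ws wt
  (c.w.w0 == (pairing v ws.w0 wt.w0).map (· - 3 * f)) && (c.w.w1 == (pairing v ws.w1 wt.w1).map (· - 2 * f)) &&
  (c.w.w2 == (pairing v ws.w2 wt.w2).map (· - f))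

/-- (★): `N(v′+v″) ≥ 1 + ⌊N(v′)⌋ + ⌊N(v″)⌋` -/
def starHolds (v' v'' : ℕ × ℕ) (ws wt : W3) : Bool :=
  NgeInt (v'.1 + v''.1, v'.2 + v''.2) ws wt (1 + floorN v' ws wt + floorN v'' ws wt)

/-- PHASE 1 (the TOP CASCADE, blow-ups first): forced deep accepts, else blow up the first TOP node (α = 3), else stop.
Rays are carried along (`V(t) = (0,1)`, `V(s) = (1,0)`, newborn = `v′ + v″`). Returns `false` if some blown-up top node violates (★),
or if at the end some curve violates the closed form or some adjacent pair satisfies (★) (it should not: no node is top any more). -/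
def cascadeCheck : ℕ → W3 → W3 → Chain → List (ℕ × ℕ) → Bool
  | 0, _, _, _, _ => false
  | fuel + 1, ws, wt, ch, rays =>
    let n := ch.length
    match (List.range n).find? (fun k => kindAt ch k == .deep) with
    | some k => cascadeCheck fuel ws wt (applyMove ch (.D k)) rays
    | none =>
      match (List.range (n - 1)).find? (topAt ch) with
      | some i =>
        let v' := rays.getD i (0,0); let v'' := rays.getD (i+1) (0,0)
        starHolds v' v'' ws wt && cascadeCheck fuel ws wt (applyMove ch (.I i)) (rays.insertIdx (i+1) (v'.1 + v''.1, v'.2 + v''.2))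
      | none =>
        (List.range n).all (fun k => match ch[k]? with
            | some c => closedFormHolds (rays.getD k (0,0)) ws wt c | none => false) &&
        (List.range (n - 1)).all (fun i => !starHolds (rays.getD i (0,0)) (rays.getD (i+1) (0,0)) ws wt)

/-- S3 BOX CERTIFICATE (mode `uv`): the closed form and the (★)-criterion on every initial state of the box -/
def boxClosedFormOK (maxw fuel : ℕ) : Bool :=
  ((allW3 maxw).flatMap fun ws => (allW3 maxw).map fun wt => (ws, wt)).all fun p =>
    !initOK true p.1 p.2 || cascadeCheck fuel p.1 p.2 (initChain true p.1 p.2) [(0,1), (1,0)]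

/-- digest for cross-validation against the Python reference: (n, Σ lengths, max length, histogram) -/
def boxDigest (topj : ℕ) (modeUV : Bool) (maxw fuel : ℕ) : ℕ × ℕ × ℕ × List (ℕ × ℕ) :=
  let ss := initStates modeUV maxw
  let ls := ss.map fun ch => ((runDet topj fuel ch).map (·.1)).getD 9999
  let mx := ls.foldl max 0
  (ss.length, ls.foldl (· + ·) 0, mx, (List.range (mx + 1)).filterMap fun k =>
     let c := (ls.filter (· == k)).length; if c == 0 then none else some (k, c))




/-- collect the reachable (state, move) events whose census row has entry `j` set -/
def findEvents (topj j : ℕ) : ℕ → Chain → Seen × List (Chain × Move) → Seen × List (Chain × Move)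
  | 0, _, acc => acc
  | fuel + 1, ch, acc =>
    if acc.1.contains ch then acc else
    let ms := legalMoves topj ch
    let hits := ms.filter (fun m => ((eventFlags ch m)[j]?).getD false)
    ms.foldl (fun (a : Seen × List (Chain × Move)) m => findEvents topj j fuel (applyMove ch m) a)
      (acc.1.insert ch (), acc.2 ++ hits.map (fun m => (ch, m)))

def boxFind (topj j : ℕ) (modeUV : Bool) (maxw fuel : ℕ) : List (Chain × Move) :=
  ((initStates modeUV maxw).foldl (fun a ch => findEvents topj j fuel ch a) (({} : Seen), [])).2

/-- STATE-LEVEL PATTERNS around cubic-weighted curves (the data behind loop note §9.15): `[s1] ∃ node (A,N): w₃(N) ≥ 1, A a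
boundary curve of class 𝒞`; `[s2]` the same with `A` handled (deep / borderline / relevant light); `[s3] ∃ TOP node with o₃ ≥ 1`;
`[s4] ∃ Sing₂ node with o₃ ≥ 1 on a handled curve`; `[s5] ∃ Sing₂ node (A,N)` as in `s1`.  (`s1`–`s5` are all `0` on the boxes ≤ 4
in mode `uv` and under `G_mult`; `s1` is NOT an invariant of the game — it fails in box 5, `inv5Seed` below — which is why §9.15
argues through birth order and the far-side quantity `w₀ − 3w₂` instead.) -/
def invFlags (ch : Chain) : List Bool :=
  let n := ch.length
  let nodes := List.range (n - 1)
  let pairOK (i : ℕ) (f : Curve → Curve → Bool) : Bool := match nodeAt ch i with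
    | some (a, b) => f a b || f b a | none => false
  let s1 := nodes.any fun i => pairOK i fun a nb => a.bd && isCW a.w && Nat.ble 1 nb.w3
  let s2 := nodes.any fun i => (match nodeAt ch i with
    | some (a, b) => (Nat.ble 1 b.w3 && handled ch i) || (Nat.ble 1 a.w3 && handled ch (i+1)) | none => false)
  let s3 := nodes.any fun i => (match nodeAt ch i with
    | some (a, b) => topN a b && Nat.ble 1 (a.w3 + b.w3) | none => false)
  let s4 := nodes.any fun i => (match nodeAt ch i with
    | some (a, b) => sing2N a b && Nat.ble 1 (a.w3 + b.w3) && (handled ch i || handled ch (i+1)) | none => false)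
  let s5 := nodes.any fun i => (match nodeAt ch i with
    | some (a, b) => sing2N a b && ((a.bd && isCW a.w && Nat.ble 1 b.w3) || (b.bd && isCW b.w && Nat.ble 1 a.w3)) | none => false)
  [s1, s2, s3, s4, s5]

def invCensus (topj : ℕ) : ℕ → Chain → Seen × List ℕ → Seen × List ℕ
  | 0, _, acc => acc
  | fuel + 1, ch, acc =>
    if acc.1.contains ch then acc else
    let ms := legalMoves topj ch
    ms.foldl (fun (a : Seen × List ℕ) m => invCensus topj fuel (applyMove ch m) a)
      (acc.1.insert ch (), addCounts acc.2 (invFlags ch))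

def boxInv (topj : ℕ) (modeUV : Bool) (maxw fuel : ℕ) : ℕ × List ℕ :=
  let r := (initStates modeUV maxw).foldl (fun a ch => invCensus topj fuel ch a) (({} : Seen), [0,0,0,0,0])
  (r.1.size, r.2)



/-! ### S2 (abelian): persistence and local commutation of legal MACRO moves (deep-first normalised), up to index shift -/

/-- re-index move `m` after move `m'` has been played (a blow-up at node `i` inserts a curve at position `i+1`). -/
def shiftMove (m' m : Move) : Move :=
  let sh (i : ℕ) : Move → Move
    | .D k => .D (if i < k then k + 1 else k)
    | .A k => .A (if i < k then k + 1 else k)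
    | .AL k => .AL (if i < k then k + 1 else k)
    | .I j => .I (if i < j then j + 1 else j)
    | .P j => .P (if i < j then j + 1 else j)
  match m' with
  | .I i => sh i m
  | .P i => sh i m
  | _ => m

/-- deep-first normalisation: accept deep boundary curves until none is left (D-moves never shift indices). -/
def settle : ℕ → Chain → Chain
  | 0, ch => ch
  | fuel + 1, ch =>
    match (List.range ch.length).find? (fun k => kindAt ch k == .deep) with
    | some k => settle fuel (applyMove ch (.D k))
    | none => ch

/-- a MACRO move: the move followed by the forced deep accepts. (Literal persistence fails exactly when a move creates a deep
newborn, which pre-empts everything else for one step — 128 such states in box 4; the sheet's S2 is the statement for macro moves.) -/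
def macroStep (ch : Chain) (m : Move) : Chain := settle 60 (applyMove ch m)

/-- at the settled state `ch`: every ordered pair of distinct legal moves `(m, m')` has `m` (re-indexed) legal after the macro move
`m'` (PERSISTENCE), and the two orders give the same settled state (LOCAL COMMUTATION). -/
def abelianAtM (topj : ℕ) (ch : Chain) : Bool :=
  let ms := legalMoves topj ch
  ms.all fun m => ms.all fun m' => m == m' ||
    ((legalMoves topj (macroStep ch m')).contains (shiftMove m' m) &&
     macroStep (macroStep ch m') (shiftMove m' m) == macroStep (macroStep ch m) (shiftMove m m'))

def abelianCensusM (topj : ℕ) : ℕ → Chain → Seen × (ℕ × ℕ × ℕ) → Seen × (ℕ × ℕ × ℕ)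
  | 0, _, acc => acc
  | fuel + 1, ch, acc =>
    if acc.1.contains ch then acc else
    let ms := legalMoves topj ch
    let k := ms.length
    let cnt := (acc.2.1 + 1, acc.2.2.1 + k * (k - 1), acc.2.2.2 + (if abelianAtM topj ch then 0 else 1))
    ms.foldl (fun (a : Seen × (ℕ × ℕ × ℕ)) m => abelianCensusM topj fuel (macroStep ch m) a) (acc.1.insert ch (), cnt)

/-- S2 BOX CHECK `(settled states reached, ordered pairs of distinct legal moves examined, states where persistence or commutation
fails)`.  Measured beyond the theorems below (one-off `#eval`, ≈ 4–5 min each, not shipped): `boxAbelianM 0 true 4 80 =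
(98430, 1152556, 0)`, `boxAbelianM 2 false 4 80 = (84131, 847890, 0)`. -/
def boxAbelianM (topj : ℕ) (modeUV : Bool) (maxw fuel : ℕ) : ℕ × ℕ × ℕ :=
  ((initStates modeUV maxw).foldl (fun a ch => abelianCensusM topj fuel (settle 60 ch) a) (({} : Seen), (0, 0, 0))).2


/-! ### (F2) of loop note §9.15: the structural facts that separate the permissible rule sets from rev 2 -/

/-- per (state, move): `[x1]` an A/AL accept whose centre has `w₀ ≠ 2`; `[x2]` an α = 2 point blow-up (P at a non-top point) whose
newborn has `w₀ ≠ 0`; `[x3]` an A/AL accept such that some Sing₂ point of the centre has a 𝒟-partner with `w₀ ≠ 0` (resp. lies on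
the residual branch with `c₀ ≠ 0`).  §9.15 (F2): all three are `0` in every legal play in mode `uv` and under `G_mult`. -/
def f2Flags (ch : Chain) (m : Move) : List Bool :=
  match m with
  | .A k | .AL k =>
    match ch[k]? with
    | some c =>
      let x1 := !(c.w.w0 == some 2)
      let x3 := (List.range (ch.length - 1)).any fun i =>
        (i == k || i + 1 == k) && sing2At ch i &&
          (match (if i == k then ch[k+1]? else ch[i]?) with
           | some p => !(p.w.w0 == some 0)
           | none => false)
      [x1, false, x3]
    | none => [false, false, false]
  | .P i =>
    let x2 := !topAt ch i && (match (applyMove ch m)[i+1]? with | some c => !(c.w.w0 == some 0) | none => false)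
    [false, x2, false]
  | _ => [false, false, false]

def f2Census (topj : ℕ) : ℕ → Chain → Seen × List ℕ → Seen × List ℕ
  | 0, _, acc => acc
  | fuel + 1, ch, acc =>
    if acc.1.contains ch then acc else
    let ms := legalMoves topj ch
    let cnt := ms.foldl (fun a m => addCounts a (f2Flags ch m)) acc.2
    ms.foldl (fun (a : Seen × List ℕ) m => f2Census topj fuel (applyMove ch m) a) (acc.1.insert ch (), cnt)

/-- (F2) BOX CENSUS `[x1, x2, x3]` summed over every reachable (state, legal move) of the box. -/
def boxF2 (topj : ℕ) (modeUV : Bool) (maxw fuel : ℕ) : List ℕ :=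
  ((initStates modeUV maxw).foldl (fun a ch => f2Census topj fuel ch a) (({} : Seen), [0, 0, 0])).2

/-! ### Seeds used in §C -/

/-- the T-chain witness of E-S6(iv): `f = z³/3 + y³/3 + 3yu⁴v + 2y²uv`, `E = {u}` (mode `u`): `w(V(s)) = (∞,4,1)`, `c = (∞,1,1)`. -/
def tchainSeed : Chain := initChain false ⟨none, some 4, some 1⟩ ⟨none, some 1, some 1⟩

/-- the loose-legality seed of loop note 9.9 (`cas/loose_inf.txt`): `w(V(t)) = (2,2,0)`, `w(V(s)) = (0,0,1)`. -/
def looseSeed : Chain := initChain true ⟨some 0, some 0, some 1⟩ ⟨some 2, some 2, some 0⟩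

/-- the state after `k` LOOSE moves `P 0` from `looseSeed`: `(2,2,0);0 — (0,k,1);k — (0,k-1,1);k-1 — ⋯ — (0,0,1);0`. -/
def looseTail : ℕ → Chain
  | 0 => []
  | k + 1 => ⟨⟨some 0, some k, some 1⟩, k, true⟩ :: looseTail k
def looseChain (k : ℕ) : Chain := ⟨⟨some 2, some 2, some 0⟩, 0, true⟩ :: looseTail (k + 1)

/-- is `l` a play under LOOSE legality? -/
def isLoosePlay (topj : ℕ) : Chain → List Move → Bool
  | _, [] => true
  | ch, m :: l => (looseMoves topj ch).contains m && isLoosePlay topj (applyMove ch m) l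

/-- the box-5 seed on which the naive pattern `s1` fails (harmlessly): `w(V(s)) = (5,2,0)`, `w(V(t)) = (0,1,1)`, mode `uv`. -/
def inv5Seed : Chain := initChain true ⟨some 5, some 2, some 0⟩ ⟨some 0, some 1, some 1⟩


/-! ## §B′–§B⁶ (revs 4–9) — the KERNEL THEOREMS FOR ALL CHAINS AND ALL LEGAL PLAYS — live since rev 10 in the sibling workfile
`Lines/toric_sgame_allchains.lean` (namespace `….ToricSGame.AllChains`, over a verbatim copy of the model core of §B above), because a crux
workfile is capped at 200 000 bytes: (F2) `F2_*`; LEMMA 9.15 (3) `lemma3_*`, `cubic_w0_*`; THEOREM 9.15 (4) `monic_centres_*`,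
`monic_neighbours_*`, `residual_shape_*`, `top_noCubic_*`; PROPOSITION 9.15 (5) `farside_*`, `prop5_*`; and the headline
`monic_neighbours_all_gmult|uv` (THEOREM (4) in full, every accept, every point, every seed). -/

/-! ## §C. Certificates

Kernel level (`decide`, no extra axioms): the seed statements.  Compiler level (`native_decide`, axiom `Lean.ofReduceBool`): the box
statements — censuses over ALL legal plays from every Sing₂-origin seed of the box (`maxw` bounds every finite exponent; `∞` allowed
where the sheet allows it).  Total evaluation time on the farm ≈ 4 min; larger boxes are quoted in docstrings as measured, not shipped. -/

section Seeds

/-- E-S6(iv) WITNESS (loop-note rev 2 rules, mode `u`): the T-chain play `D, AL, AL` is legal and complete; its second move is an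
α=2 accept THROUGH A TOP POINT (`a5`), its third moreover has a cubic-weighted light centre (`a3`) and creates a MULTIPLICITY-3
POINT OFF S over the T-node (`a6`); the end state carries `w₃ = 2` on the accepted line. -/
theorem tchain_rev2_play : isLegalPlay 0 tchainSeed [.D 1, .AL 1, .AL 1] = true := by decide
theorem tchain_rev2_flags₂ : eventFlags (applyMoves tchainSeed [.D 1]) (.AL 1) =
    [true, false, false, false, false, false, false, false, true, false, false] := by decide
theorem tchain_rev2_flags₃ : eventFlags (applyMoves tchainSeed [.D 1, .AL 1]) (.AL 1) =
    [true, false, false, false, false, false, true, false, true, true, false] := by decide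
theorem tchain_rev2_allorders : explore 0 20 tchainSeed =
    some (3, [⟨⟨none, some 1, some 1⟩, 0, false⟩, ⟨⟨none, some 0, some 0⟩, 2, true⟩]) := by decide
/-- … whereas under `G_mult` the top T-point is blown up first and the newborn's T-point is top again (`D, I, I`; after that nothing is
singular and the light curve is never accepted), every complete play has length 3, and no cubic weight is ever created (E-S6(iv) does not occur). -/
theorem tchain_gmult_allorders : explore 2 20 tchainSeed =
    some (3, [⟨⟨none, some 1, some 1⟩, 0, false⟩, ⟨⟨none, some 0, some 0⟩, 0, true⟩, ⟨⟨none, some 1, some 0⟩, 0, true⟩,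
      ⟨⟨none, some 2, some 0⟩, 0, true⟩]) := by decide
theorem tchain_gmult_not_rev2 : isLegalPlay 2 tchainSeed [.D 1, .AL 1] = false := by decide

/-- LOOSE LEGALITY DOES NOT TERMINATE (loop note 9.9 / sheet S4): from `looseSeed` the strict game has the single legal move `AL 0`
(and terminates), but under loose legality the point blow-up `P 0` is legal twelve times in a row, producing the states `looseChain k`
(by the evident pattern — `(2,2,0)` meets `(0,k,1)` in a non-top Sing₂ point `(2,k+2,1)` with both curves unhandled — for every `k`). -/
theorem loose_strict_moves : legalMoves 0 looseSeed = [.AL 0] := by decide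
theorem loose_prefix_legal : isLoosePlay 0 looseSeed (List.replicate 12 (.P 0)) = true := by decide
theorem loose_prefix_state : applyMoves looseSeed (List.replicate 12 (.P 0)) = looseChain 12 := by decide
theorem loose_step (k : ℕ) (hk : k ≤ 40) : applyMove (looseChain k) (.P 0) = looseChain (k + 1) ∧
    (looseMoves 0 (looseChain k)).contains (.P 0) = true := by
  interval_cases k <;> exact ⟨by decide, by decide⟩

/-- THE NAIVE PATTERN IS NOT AN INVARIANT: from `inv5Seed` (box 5, mode `uv`) every complete play (`I 0, AL 1`) ends with the
cubic-weighted accepted line `(0,0,0);1` ADJACENT to the class-𝒞 curve `V(s) = (5,2,0)` (pattern `s1`), harmlessly: `V(s)` is never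
accepted (its points are not Sing₂), so the neighbours' lemma is not violated — cf. loop note §9.15, which therefore argues differently. -/
theorem inv5_allorders : explore 0 10 inv5Seed =
    some (2, [⟨⟨some 0, some 1, some 1⟩, 0, true⟩, ⟨⟨some 0, some 0, some 0⟩, 1, true⟩, ⟨⟨some 5, some 2, some 0⟩, 0, true⟩]) := by
  decide
theorem inv5_pattern : ((explore 0 10 inv5Seed).map fun p => invFlags p.2) = some [true, false, false, false, false] := by decide

/-- the example of loop note 9.6 (two transversal cusps `y³ + z³/3 + u²v^∞…`, i.e. `w(V(s)) = w(V(t)) = (2,∞,∞)`): 5 moves in every order. -/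
theorem cusp_pair_allorders : (explore 1 12 (initChain true ⟨some 2, none, none⟩ ⟨some 2, none, none⟩)).map Prod.fst = some 5 := by
  decide

end Seeds

section Boxes

/-! #### cross-validation digests `(states, Σ lengths, max length, histogram)` — identical to `cas/ref_stats.py` on the Python reference -/
theorem digest_uv2 : boxDigest 0 true 2 40 = (440, 683, 5, [(1, 289), (2, 98), (3, 24), (4, 19), (5, 10)]) := by native_decide
theorem digest_uv3 : boxDigest 0 true 3 60 = (3135, 6083, 14,
    [(1, 1754), (2, 810), (3, 207), (4, 119), (5, 122), (6, 69), (8, 2), (9, 16), (10, 2), (11, 22), (13, 2), (14, 10)]) := by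
  native_decide
theorem digest_u2_rev2 : boxDigest 0 false 2 40 = (287, 403, 4, [(1, 231), (2, 16), (3, 20), (4, 20)]) := by native_decide
theorem digest_u2_topj1 : boxDigest 1 false 2 40 = (287, 419, 4, [(1, 215), (2, 32), (3, 20), (4, 20)]) := by native_decide
theorem digest_u2_gmult : boxDigest 2 false 2 40 = (287, 447, 4, [(1, 187), (2, 60), (3, 20), (4, 20)]) := by native_decide
theorem digest_u3_rev2 : boxDigest 0 false 3 60 = (2103, 4072, 14,
    [(1, 1399), (2, 221), (3, 177), (4, 163), (5, 52), (6, 37), (8, 8), (9, 10), (10, 13), (11, 11), (13, 7), (14, 5)]) := by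
  native_decide
theorem digest_u3_gmult : boxDigest 2 false 3 60 = (2103, 4251, 14,
    [(1, 1229), (2, 382), (3, 186), (4, 163), (5, 52), (6, 37), (8, 8), (9, 10), (10, 13), (11, 11), (13, 7), (14, 5)]) := by
  native_decide

/-! #### S4 ALL ORDERS: from every seed of the box every complete play has the same length and the same end state, and a complete
play exists within the fuel (boxes ≤ 4; box 5 mode `uv` measured `true` in 220 s, not shipped) -/
theorem allorders_uv3 : boxAllOrdersOK 0 true 3 60 = true := by native_decide
theorem allorders_u3_rev2 : boxAllOrdersOK 0 false 3 60 = true := by native_decide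
theorem allorders_u3_gmult : boxAllOrdersOK 2 false 3 60 = true := by native_decide
theorem allorders_uv4 : boxAllOrdersOK 0 true 4 80 = true := by native_decide
theorem allorders_u4_rev2 : boxAllOrdersOK 0 false 4 80 = true := by native_decide
theorem allorders_u4_gmult : boxAllOrdersOK 2 false 4 80 = true := by native_decide

/-! #### S2 MACRO-ABELIAN on box 3: `(settled states, ordered legal pairs, failures)` -/
theorem abelian_uv3 : boxAbelianM 0 true 3 60 = (12600, 52600, 0) := by native_decide
theorem abelian_u3_rev2 : boxAbelianM 0 false 3 60 = (9514, 31400, 0) := by native_decide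
theorem abelian_u3_gmult : boxAbelianM 2 false 3 60 = (10055, 35342, 0) := by native_decide

/-! #### S3 CLOSED FORM (mode `uv`, monomial data, boxes ≤ 5): deterministic length = `closedForm` with the creation criterion (★) -/
theorem closedForm_box4 : boxClosedFormOK 4 80 = true := by native_decide
theorem closedForm_box5 : boxClosedFormOK 5 100 = true := by native_decide

/-! #### S6 (OFF-S) EVENT CENSUS over all legal plays: `(#states, [#events, b1, b2, b3, a1, a2, a3, a4, a5, a6, #Bennett])` -/
theorem census_uv3 : boxCensus 0 true 3 60 = (13681, [24477, 0, 0, 32, 0, 0, 0, 0, 0, 0, 0]) := by native_decide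
theorem census_u3_gmult : boxCensus 2 false 3 60 = (10552, [18168, 0, 0, 16, 0, 0, 0, 0, 0, 0, 0]) := by native_decide
theorem census_u3_rev2 : boxCensus 0 false 3 60 = (10011, [16643, 18, 0, 16, 0, 0, 4, 0, 622, 4, 0]) := by native_decide
theorem census_uv4 : boxCensus 0 true 4 80 = (105565, [330748, 0, 0, 150, 0, 0, 0, 0, 0, 0, 0]) := by native_decide
theorem census_u4_gmult : boxCensus 2 false 4 80 = (87571, [263014, 0, 0, 75, 0, 0, 0, 0, 0, 0, 0]) := by native_decide
theorem census_u4_rev2 : boxCensus 0 false 4 80 = (81762, [239129, 70, 0, 81, 0, 0, 67, 3, 4631, 52, 0]) := by native_decide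

/-- ERRATUM E-9.14(5) made precise: under the WITHDRAWN rev-2 rules in mode `u`, box 4, exactly three reachable (state, move) events
accept a light line next to a cubic-weighted neighbour — all inside T-chains over `c = (4,1,1)` (seeds `w(V(s)) ∈ {(2,4,0),(3,3,0),
(3,4,0)}`); none exists in mode `uv` or under `G_mult` (`census_uv4`, `census_u4_gmult`: entry `a4 = 0`). -/
theorem rev2_u4_neighbour_events : boxFind 0 7 false 4 80 =
    [([⟨⟨some 4, some 1, some 1⟩, 0, false⟩, ⟨⟨some 2, some 1, some 0⟩, 1, true⟩, ⟨⟨some 1, some 2, some 0⟩, 1, true⟩,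
       ⟨⟨some 0, some 3, some 0⟩, 1, true⟩], .AL 1),
     ([⟨⟨some 4, some 1, some 1⟩, 0, false⟩, ⟨⟨some 2, some 1, some 0⟩, 1, true⟩, ⟨⟨some 1, some 2, some 0⟩, 1, true⟩], .AL 1),
     ([⟨⟨some 4, some 1, some 1⟩, 0, false⟩, ⟨⟨some 2, some 2, some 0⟩, 1, true⟩, ⟨⟨some 1, some 3, some 0⟩, 1, true⟩], .AL 1)] := by
  native_decide


/-! #### (F2) of §9.15 on box 4: every A/AL centre has w₀ = 2, every (Q₂)-type newborn has w₀ = 0, every Sing₂ point of an accepted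
light/borderline centre has partner w₀ = 0 (c₀ = 0) — in mode `uv` and under `G_mult`; massively violated by the withdrawn rev-2 rules -/
theorem f2_uv4 : boxF2 0 true 4 80 = [0, 0, 0] := by native_decide
theorem f2_u4_gmult : boxF2 2 false 4 80 = [0, 0, 0] := by native_decide
theorem f2_u4_rev2 : boxF2 0 false 4 80 = [1164, 0, 4543] := by native_decide

/-! #### state patterns `[s1,…,s5]` around cubic-weighted curves (all absent in boxes ≤ 4, mode `uv` and `G_mult`; present under rev 2) -/
theorem patterns_uv4 : boxInv 0 true 4 80 = (105565, [0, 0, 0, 0, 0]) := by native_decide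
theorem patterns_u4_gmult : boxInv 2 false 4 80 = (87571, [0, 0, 0, 0, 0]) := by native_decide
theorem patterns_u4_rev2 : boxInv 0 false 4 80 = (81762, [6, 3, 122, 67, 0]) := by native_decide

end Boxes

end Summit.ResolutionOfSingularities.ResolutionOfSingularities.Cruxes.DescentPerfectToAll.GiraudWeakNormalForm.ToricSGame
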